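import Summits.ABC.IUTFork.Joshi.ATS4LogDiffConductor
import Literature.IUT.LogVolume.DifferentConductorTower
import HarnessLib

/-!
# Joshi, *Arithmetic Teichmüller Spaces IV* (arXiv:2403.10430v2) Thm. 4.6.1 (1): the EXACT identity behind the
# log-Different + log-Conductor Theorem over Mathlib number fields — PROVED, with the located correction (flag F-b)

Proof-only companion of `Joshi/ATS4LogDiffConductor.lean` (abc-iut cell, branch E, rung LADDER-ABC:A2.E; seat abc-iut-E-t27,
slot T-27). **No side is taken** on [IUTchIII] Cor. 3.12, on Joshi's claims, or on Mochizuki's reports on them; the source is an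
unrefereed arXiv preprint. Locators «p.N l.M» refer to the render `HOME/lit/renders/Joshi-arxiv-2403.10430/` (v2).

WHAT IS PROVED (for EVERY extension of number fields `M/L` and every finite set `S` of primes of `L`, `T := ssAbove L M S` the
primes of `M` over `S`; `d_w = ord_w 𝔡_{M/L}`, `e_w = e(w | w ∩ 𝓞_L)`, `τ_w = d_w − (e_w − 1) ≥ 0`, `log N(w) = f_w·log N(v)`):

* `finrank_mul_delta_eq` — `[M:ℚ]·((log d_M + log f_M) − (log d_L + log f_L)) = Σ_{w ∈ D} d_w·log N(w) − Σ_{w ∈ T} (e_w − 1)·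
  log N(w)` for any finite `D ⊇ T` carrying the relative different (this is (4.6.3)–(4.6.5) MINUS the conductor computation
  done with `f` supported on `V^{odd,ss}` as §4.4 defines it — cf. (4.6.6), p.47 l.41–108, which sums over all places);
* `finrank_mul_delta_eq_tau_add` — the same RHS rewritten as `Σ_{w ∈ D} τ_w·log N(w) + Σ_{w ∈ D, w ∉ T} (e_w − 1)·log N(w)`:
  Joshi's (4.6.8) (p.48 l.14–24) PLUS the nonnegative term the printed derivation drops (flag F-b of the typed file);
* `delta_ge_of_not_mem` — hence `(log d_M + log f_M) − (log d_L + log f_L) ≥ [M:ℚ]⁻¹·(e_w − 1)·log N(w)` for every prime `w`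
  of `M` OUTSIDE `V^{odd,ss}_M`: the difference is `> 0` as soon as `M/L` ramifies (even tamely) at one prime outside
  `V^{odd,ss}_M` (`delta_pos_of_ramified_outside`) — so Thm. 4.6.1 (3)/(4) as printed («depends only on wildly ramified primes»,
  «equality iff M/L is tamely ramified», p.46 l.38–41) presuppose «M/L unramified outside V^{odd,ss}_L» (LOCATED, kernel form;
  the ref-x lane double-reads; nothing adjudicated about any other text);
* `tau_eq_zero_of_isTameAt'` — at a tamely ramified prime `τ_w = 0` (the tree's Neukirch III (2.6) / Serre III §6 lemma
  `Literature.NumberTheory.NumberFields.multiplicity_differentIdeal_eq_of_not_dvd`), the «τ_{w|v} = 0 if w|v is tamely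
  ramified» half of (4.6.4) (p.47 l.20–24);
* `delta_eq_zero_of_isTame_of_unramified_outside` — the CORRECTED (4): if `M/L` is tamely ramified everywhere and unramified
  outside `V^{odd,ss}_M`, then `log d_M + log f_M = log d_L + log f_L`.

Vocabulary: the identity is proved in the tree's arithmetic-divisor language (`Literature.IUT.LogVolume.ndeg`, `differentDivisor`,
`relDifferentDivisor`, `ADivisor.reduced`; engine `DifferentConductorTower.lean`, [IUTchIV] Thm. 1.10 Step (ii) for real fields)
and transported to the typed `LogDiffCond.logDiffCond` by `logDiff_eq_ndeg_differentDivisor` / `logRedTate_eq_ndeg_reduced`; the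
glue `relRamIdx_eq` (Mathlib `ramificationIdx'` = `Ideal.ramificationIdx`), `relDiffExp_eq_multiplicity` (`Associates.count` =
`multiplicity`), `residueChar_eq` (`ringChar (𝓞 M ⧸ w)` = the cell's `residueChar`) identifies the typed §4.6 quantities with
the tree's. Theorems only; standard axioms; no `sorry`, instance, notation or new `Prop` fact.
[claim: Joshi2024ATS4, status: disputed] (provenance of the typed items; nothing endorsed).
-/

noncomputable section

namespace Summit.ABC.IUTFork.Joshi.ATS4

namespace LogDiffCond

open NumberField IsDedekindDomain Ideal Module Literature.IUT.LogVolume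
open Literature.NumberTheory.NumberFields (ramificationIdx_sub_one_le_multiplicity_differentIdeal
  multiplicity_differentIdeal_eq_of_not_dvd multiplicity_differentIdeal_eq_zero_of_ramificationIdx_eq_one
  natCast_mem_iff_absNorm_under_dvd)
open scoped Classical

variable (L M : Type*) [Field L] [NumberField L] [Field M] [NumberField M] [Algebra L M]

/-! ### Glue: the typed §4.6 quantities are the tree's / Mathlib's -/

/-- `log d_M` (typed: `[M:ℚ]⁻¹·log N(𝔡_{𝓞_M/ℤ})`) is the normalised degree of the tree's different divisor. [folklore] -/
theorem logDiff_eq_ndeg_differentDivisor (M : Type*) [Field M] [NumberField M] :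
    logDiff M = ndeg M (differentDivisor M) := by
  rw [logDiff_eq_log_discr, ndeg_apply, degF_differentDivisor, div_eq_inv_mul]

/-- `log f_M(T)` (typed) is the normalised degree of the tree's reduced divisor `Σ_{w ∈ T} w`. [folklore] -/
theorem logRedTate_eq_ndeg_reduced (M : Type*) [Field M] [NumberField M] (T : Finset (HeightOneSpectrum (𝓞 M))) :
    logRedTate M T = ndeg M (ADivisor.reduced T) := by
  rw [logRedTate, ndeg_apply, ADivisor.degF_reduced_eq_sum, div_eq_inv_mul]
  rfl

/-- `log d_M + log f_M(T)` in the tree's vocabulary. [folklore] -/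
theorem logDiffCond_eq_ndeg (M : Type*) [Field M] [NumberField M] (T : Finset (HeightOneSpectrum (𝓞 M))) :
    logDiffCond M T = ndeg M (differentDivisor M) + ndeg M (ADivisor.reduced T) := by
  rw [logDiffCond, logDiff_eq_ndeg_differentDivisor, logRedTate_eq_ndeg_reduced]

omit [NumberField L] in
/-- `e_{w|v}`: the typed `relRamIdx` (Mathlib `Ideal.ramificationIdx'` of `w` over `w ∩ 𝓞_L`) is Mathlib's `Ideal.ramificationIdx`
of `w` over `𝓞_L`. [folklore] -/
theorem relRamIdx_eq (w : HeightOneSpectrum (𝓞 M)) : relRamIdx L M w = w.asIdeal.ramificationIdx (𝓞 L) := by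
  haveI := w.isPrime
  exact Ideal.ramificationIdx'_eq_ramificationIdx (w.asIdeal.under (𝓞 L)) w.asIdeal (w.under (𝓞 L)).ne_bot

/-- `1 ≤ e_{w|v}`. [folklore] -/
theorem one_le_relRamIdx (w : HeightOneSpectrum (𝓞 M)) : 1 ≤ relRamIdx L M w := by
  haveI := w.isPrime
  rw [relRamIdx_eq]
  exact Ideal.ramificationIdx_pos w.asIdeal (𝓞 L)

omit [NumberField L] [Algebra L M] in
/-- `ord_w(I)`: the typed `ordIdeal` (exponent in the factorisation, `Associates.count`) is Mathlib's `multiplicity`, for `I ≠ 0`.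
[folklore] -/
theorem ordIdeal_eq_multiplicity (w : HeightOneSpectrum (𝓞 M)) {I : Ideal (𝓞 M)} (hI : I ≠ ⊥) :
    ordIdeal w I = multiplicity w.asIdeal I := by
  classical
  rw [ordIdeal, Ideal.count_associates_factors_eq hI w.isPrime w.ne_bot,
    UniqueFactorizationMonoid.multiplicity_eq_count_normalizedFactors w.irreducible hI, normalize_eq]

/-- `d_{w|v}`: the typed `relDiffExp` is `ord_w 𝔡_{M/L}` as Mathlib's `multiplicity`. [folklore] -/
theorem relDiffExp_eq_multiplicity (w : HeightOneSpectrum (𝓞 M)) :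
    relDiffExp L M w = multiplicity w.asIdeal (differentIdeal (𝓞 L) (𝓞 M)) :=
  ordIdeal_eq_multiplicity M w (relDifferentIdeal_ne_bot L M)

/-- Dedekind: `e_{w|v} − 1 ≤ d_{w|v}` (Mathlib `pow_sub_one_dvd_differentIdeal`, via the tree), so `d = (e − 1) + τ` with the typed
`τ_{w|v} = d_{w|v} − (e_{w|v} − 1)` ((4.6.4), p.47 l.16–19). [cite: BombieriGubler2006, Thm B.2.12] -/
theorem relDiffExp_eq_tau_add (w : HeightOneSpectrum (𝓞 M)) :
    relDiffExp L M w = tau L M w + (relRamIdx L M w - 1) := by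
  haveI := w.isMaximal
  have h := ramificationIdx_sub_one_le_multiplicity_differentIdeal L M w.asIdeal
  rw [← relRamIdx_eq, ← relDiffExp_eq_multiplicity] at h
  unfold tau
  omega

omit [NumberField L] [NumberField M] [Algebra L M] in
/-- The residue characteristic: the typed `residueChar` (`ringChar (𝓞 M ⧸ w)`) is the cell's `residueChar` (`N(w ∩ ℤ)`, the
rational prime under `w`). [folklore] -/
theorem residueChar_eq (w : HeightOneSpectrum (𝓞 M)) :
    LogDiffCond.residueChar M w = Literature.IUT.LogVolume.residueChar M w := by
  have hprime : (Literature.IUT.LogVolume.residueChar M w).Prime := residueChar_prime M w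
  have hmem : ((Literature.IUT.LogVolume.residueChar M w : ℕ) : 𝓞 M) ∈ w.asIdeal :=
    (natCast_mem_iff_absNorm_under_dvd M w.asIdeal _).mpr dvd_rfl
  haveI : Nontrivial (𝓞 M ⧸ w.asIdeal) := Ideal.Quotient.nontrivial_iff.mpr w.isPrime.ne_top
  refine CharP.ringChar_of_prime_eq_zero hprime ?_
  rw [← map_natCast (Ideal.Quotient.mk w.asIdeal), Ideal.Quotient.eq_zero_iff_mem]
  exact hmem

omit [NumberField L] in
/-- `IsTameAt` in the tree's terms: `p_w ∤ e(w | w ∩ 𝓞_L)`. [folklore] -/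
theorem isTameAt_iff (w : HeightOneSpectrum (𝓞 M)) :
    IsTameAt L M w ↔ ¬ Ideal.absNorm (w.asIdeal.under ℤ) ∣ w.asIdeal.ramificationIdx (𝓞 L) := by
  rw [IsTameAt, residueChar_eq, relRamIdx_eq]
  rfl

/-- **`τ_{w|v} = 0` at a tamely ramified prime** (the tame half of (4.6.4), p.47 l.20–24 «τ_{w|v} = 0 if w|v is tamely ramified»;
Neukirch III (2.6): `ord_w 𝔡 = e − 1`, the tree's `multiplicity_differentIdeal_eq_of_not_dvd`). PROVED.
[cite: BombieriGubler2006, Thm B.2.12] -/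
theorem tau_eq_zero_of_isTameAt' (w : HeightOneSpectrum (𝓞 M)) (hw : IsTameAt L M w) : tau L M w = 0 := by
  haveI := w.isMaximal
  have h := multiplicity_differentIdeal_eq_of_not_dvd L M w.asIdeal ((isTameAt_iff L M w).mp hw)
  rw [← relRamIdx_eq, ← relDiffExp_eq_multiplicity] at h
  simp [tau, h]

/-- At an unramified prime (`e_{w|v} = 1`) `d_{w|v} = 0` (tree: `multiplicity_differentIdeal_eq_zero_of_ramificationIdx_eq_one`).
[cite: BombieriGubler2006, Thm B.2.12] -/
theorem relDiffExp_eq_zero_of_relRamIdx_eq_one (w : HeightOneSpectrum (𝓞 M)) (hw : relRamIdx L M w = 1) :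
    relDiffExp L M w = 0 := by
  haveI := w.isMaximal
  rw [relRamIdx_eq] at hw
  rw [relDiffExp_eq_multiplicity]
  exact multiplicity_differentIdeal_eq_zero_of_ramificationIdx_eq_one L M w.asIdeal hw

/-! ### The exact identity -/

variable {L M} in
/-- `T = ssAbove L M S` in the tree's `finBelow` spelling. [folklore] -/
theorem mem_ssAbove_iff_finBelow {S : Finset (HeightOneSpectrum (𝓞 L))} (w : HeightOneSpectrum (𝓞 M)) :
    w ∈ ssAbove L M S ↔ finBelow L M w ∈ S := by
  rw [mem_ssAbove, show finBelow L M w = w.under (𝓞 L) from HeightOneSpectrum.ext rfl]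

/-- **The identity behind Thm. 4.6.1 (1), unnormalised**: for any finite set `D` of primes of `M` containing every prime dividing
`𝔡_{M/L}` (and `V^{odd,ss}_M = ssAbove L M S` the primes over `S`),
`[M:ℚ]·((log d_M + log f_M) − (log d_L + log f_L)) = Σ_{w ∈ D} d_w·log N(w) − Σ_{w ∈ V^{odd,ss}_M} (e_w − 1)·log N(w)`
((4.6.3)–(4.6.5) p.47 l.5–40 with the conductor computed on its printed support §4.4). PROVED.
[cite: MochizukiGenEll2010, Prop 1.7 (i) p.9] -/
theorem finrank_mul_delta_eq (S : Finset (HeightOneSpectrum (𝓞 L))) (D : Finset (HeightOneSpectrum (𝓞 M)))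
    (hD : ∀ w : HeightOneSpectrum (𝓞 M), relDiffExp L M w ≠ 0 → w ∈ D) :
    (finrank ℚ M : ℝ) * (logDiffCond M (ssAbove L M S) - logDiffCond L S) =
      ∑ w ∈ D, (relDiffExp L M w : ℝ) * logNorm M w -
        ∑ w ∈ ssAbove L M S, ((relRamIdx L M w : ℝ) - 1) * logNorm M w := by
  have hL : (0 : ℝ) < finrank ℚ L := by exact_mod_cast finrank_pos
  have hML : (0 : ℝ) < finrank L M := by exact_mod_cast finrank_pos
  have hne := relDifferentIdeal_ne_bot L M
  -- the relative different as a sum over `D`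
  have hdiff : degF M (relDifferentDivisor L M) = ∑ w ∈ D, (relDiffExp L M w : ℝ) * logNorm M w := by
    rw [degF_eq_sum_of_subset M (relDifferentDivisor L M) D (fun w => ADivisor.ofIdeal_apply_inl _ w)
      (fun w hw => hD w (by
        rw [relDifferentDivisor, ADivisor.ofIdeal_apply_inr hne, Nat.cast_ne_zero] at hw
        rwa [relDiffExp_eq_multiplicity]))]
    refine Finset.sum_congr rfl fun w _ => ?_
    rw [relDifferentDivisor, ADivisor.ofIdeal_apply_inr hne, relDiffExp_eq_multiplicity]
  -- the conductor side: `[M:L]·deg_L(f_L) = Σ_{w ∈ T} e_w·log N(w)`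
  have hcond : (finrank L M : ℝ) * degF L (ADivisor.reduced S) =
      ∑ w ∈ ssAbove L M S, (relRamIdx L M w : ℝ) * logNorm M w := by
    rw [finrank_mul_degF_reduced_eq_sum L M S (ssAbove L M S) (fun w => mem_ssAbove_iff_finBelow w)]
    refine Finset.sum_congr rfl fun w _ => ?_
    rw [pullbackWeight_inr_eq, relRamIdx_eq]
  -- assemble
  rw [logDiffCond_eq_ndeg, logDiffCond_eq_ndeg, ndeg_differentDivisor_tower L M, ndeg_apply M (relDifferentDivisor L M),
    ndeg_apply M (ADivisor.reduced _), ndeg_apply L (ADivisor.reduced S), ADivisor.degF_reduced_eq_sum (ssAbove L M S),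
    hdiff, finrank_rat_eq_mul (F := L) (K := M)]
  have hsub : ∑ w ∈ ssAbove L M S, ((relRamIdx L M w : ℝ) - 1) * logNorm M w =
      ∑ w ∈ ssAbove L M S, (relRamIdx L M w : ℝ) * logNorm M w - ∑ w ∈ ssAbove L M S, logNorm M w := by
    rw [← Finset.sum_sub_distrib]
    exact Finset.sum_congr rfl fun w _ => by ring
  rw [hsub, ← hcond]
  field_simp
  ring

/-- **The identity behind Thm. 4.6.1 (1) in Joshi's form (4.6.8) PLUS the located correction**: with `D` as above,
`[M:ℚ]·Δ = Σ_{w ∈ D} τ_w·log N(w) + Σ_{w ∈ D, w ∉ V^{odd,ss}_M} (e_w − 1)·log N(w)` — the first sum is the right-hand side of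
(4.6.8) (p.48 l.14–24, `τ_w·f_w·log N(v) = τ_w·log N(w)`), the second is the term the printed step (4.6.5) − (4.6.6) drops
(flag F-b). PROVED. [cite: MochizukiGenEll2010, Prop 1.7 (i) p.9] -/
theorem finrank_mul_delta_eq_tau_add (S : Finset (HeightOneSpectrum (𝓞 L))) (D : Finset (HeightOneSpectrum (𝓞 M)))
    (hTD : ssAbove L M S ⊆ D) (hD : ∀ w : HeightOneSpectrum (𝓞 M), relDiffExp L M w ≠ 0 → w ∈ D) :
    (finrank ℚ M : ℝ) * (logDiffCond M (ssAbove L M S) - logDiffCond L S) =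
      ∑ w ∈ D, (tau L M w : ℝ) * logNorm M w +
        ∑ w ∈ D with w ∉ ssAbove L M S, ((relRamIdx L M w : ℝ) - 1) * logNorm M w := by
  rw [finrank_mul_delta_eq L M S D hD]
  have hsplit : ∑ w ∈ D, (relDiffExp L M w : ℝ) * logNorm M w =
      ∑ w ∈ D, (tau L M w : ℝ) * logNorm M w + ∑ w ∈ D, ((relRamIdx L M w : ℝ) - 1) * logNorm M w := by
    rw [← Finset.sum_add_distrib]
    refine Finset.sum_congr rfl fun w _ => ?_
    rw [relDiffExp_eq_tau_add, Nat.cast_add, Nat.cast_sub (one_le_relRamIdx L M w), Nat.cast_one]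
    ring
  rw [hsplit, ← Finset.sum_filter_add_sum_filter_not D (fun w => w ∈ ssAbove L M S)
    (fun w => ((relRamIdx L M w : ℝ) - 1) * logNorm M w), Finset.filter_mem_eq_inter,
    Finset.inter_eq_right.mpr hTD]
  ring

/-- A finite set `D` as required exists: `V^{odd,ss}_M ∪ {w : w ∣ 𝔡_{M/L}}`. [folklore] -/
theorem exists_support (S : Finset (HeightOneSpectrum (𝓞 L))) :
    ∃ D : Finset (HeightOneSpectrum (𝓞 M)), ssAbove L M S ⊆ D ∧ ∀ w, relDiffExp L M w ≠ 0 → w ∈ D := by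
  have hfin := finite_setOf_multiplicity_ne_zero M (relDifferentIdeal_ne_bot L M)
  refine ⟨ssAbove L M S ∪ hfin.toFinset, Finset.subset_union_left, fun w hw => Finset.mem_union_right _ ?_⟩
  rw [Set.Finite.mem_toFinset]
  rwa [relDiffExp_eq_multiplicity] at hw

/-! ### Consequences: the located correction to (3)/(4), and the corrected (4) -/

/-- Every term of the identity is `≥ 0`: `τ_w ≥ 0`, `e_w ≥ 1`, `log N(w) > 0`. Hence **`Δ ≥ [M:ℚ]⁻¹·(e_w − 1)·log N(w)` for every
prime `w` of `M` outside `V^{odd,ss}_M`**. PROVED. [cite: MochizukiGenEll2010, Prop 1.7 (i) p.9] -/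
theorem delta_ge_of_not_mem (S : Finset (HeightOneSpectrum (𝓞 L))) (w₀ : HeightOneSpectrum (𝓞 M))
    (hw₀ : w₀ ∉ ssAbove L M S) :
    (finrank ℚ M : ℝ)⁻¹ * (((relRamIdx L M w₀ : ℝ) - 1) * logNorm M w₀) ≤
      logDiffCond M (ssAbove L M S) - logDiffCond L S := by
  have hM : (0 : ℝ) < finrank ℚ M := by exact_mod_cast finrank_pos
  obtain ⟨D₀, hTD₀, hD₀⟩ := exists_support L M S
  set D := insert w₀ D₀
  have hTD : ssAbove L M S ⊆ D := hTD₀.trans (Finset.subset_insert _ _)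
  have hD : ∀ w, relDiffExp L M w ≠ 0 → w ∈ D := fun w hw => Finset.mem_insert_of_mem (hD₀ w hw)
  have key := finrank_mul_delta_eq_tau_add L M S D hTD hD
  have hnn1 : 0 ≤ ∑ w ∈ D, (tau L M w : ℝ) * logNorm M w :=
    Finset.sum_nonneg fun w _ => mul_nonneg (Nat.cast_nonneg _) (logNorm_pos M w).le
  have hterm : ∀ w ∈ D.filter (fun w => w ∉ ssAbove L M S), 0 ≤ ((relRamIdx L M w : ℝ) - 1) * logNorm M w :=
    fun w _ => mul_nonneg (by
      have h1 : (1 : ℝ) ≤ relRamIdx L M w := by exact_mod_cast one_le_relRamIdx L M w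
      linarith) (logNorm_pos M w).le
  have hmem : w₀ ∈ D.filter (fun w => w ∉ ssAbove L M S) := by
    rw [Finset.mem_filter]; exact ⟨Finset.mem_insert_self _ _, hw₀⟩
  have hnn2 : ((relRamIdx L M w₀ : ℝ) - 1) * logNorm M w₀ ≤
      ∑ w ∈ D with w ∉ ssAbove L M S, ((relRamIdx L M w : ℝ) - 1) * logNorm M w :=
    Finset.single_le_sum hterm hmem
  have h1 : ((relRamIdx L M w₀ : ℝ) - 1) * logNorm M w₀ ≤
      (finrank ℚ M : ℝ) * (logDiffCond M (ssAbove L M S) - logDiffCond L S) := by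
    rw [key]; linarith
  calc (finrank ℚ M : ℝ)⁻¹ * (((relRamIdx L M w₀ : ℝ) - 1) * logNorm M w₀)
      ≤ (finrank ℚ M : ℝ)⁻¹ * ((finrank ℚ M : ℝ) * (logDiffCond M (ssAbove L M S) - logDiffCond L S)) :=
        mul_le_mul_of_nonneg_left h1 (inv_nonneg.mpr hM.le)
    _ = logDiffCond M (ssAbove L M S) - logDiffCond L S := by field_simp

/-- **Located correction, kernel form**: if `M/L` is RAMIFIED (tamely or not) at a prime `w₀` outside `V^{odd,ss}_M`, then
`(log d_M + log f_M) − (log d_L + log f_L) > 0`. So Thm. 4.6.1 (3) («depends only on wildly ramified primes») and the «if»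
half of (4) («equality iff M/L tamely ramified»), p.46 l.38–41, hold as printed only for `M/L` unramified outside `V^{odd,ss}_L`
(flag F-b). Located, not adjudicated. [cite: MochizukiGenEll2010, Prop 1.7 (i) p.9] -/
theorem delta_pos_of_ramified_outside (S : Finset (HeightOneSpectrum (𝓞 L))) (w₀ : HeightOneSpectrum (𝓞 M))
    (hw₀ : w₀ ∉ ssAbove L M S) (hram : relRamIdx L M w₀ ≠ 1) :
    0 < logDiffCond M (ssAbove L M S) - logDiffCond L S := by
  have hM : (0 : ℝ) < finrank ℚ M := by exact_mod_cast finrank_pos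
  have he : (1 : ℝ) < relRamIdx L M w₀ := by
    have := one_le_relRamIdx L M w₀
    exact_mod_cast lt_of_le_of_ne this (Ne.symm hram)
  have hpos : 0 < (finrank ℚ M : ℝ)⁻¹ * (((relRamIdx L M w₀ : ℝ) - 1) * logNorm M w₀) :=
    mul_pos (inv_pos.mpr hM) (mul_pos (by linarith) (logNorm_pos M w₀))
  exact hpos.trans_le (delta_ge_of_not_mem L M S w₀ hw₀)

/-- **The corrected Thm. 4.6.1 (4), «if» direction — PROVED**: if `M/L` is tamely ramified at every prime AND unramified outside
`V^{odd,ss}_M`, then `log d_M + log f_M = log d_L + log f_L` (every `τ_w = 0` by the tame lemma, every dropped term vanishes).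
[cite: MochizukiGenEll2010, Prop 1.7 (i) p.9] -/
theorem delta_eq_zero_of_isTame_of_unramified_outside (S : Finset (HeightOneSpectrum (𝓞 L))) (htame : IsTame L M)
    (hunr : ∀ w : HeightOneSpectrum (𝓞 M), w ∉ ssAbove L M S → relRamIdx L M w = 1) :
    logDiffCond M (ssAbove L M S) = logDiffCond L S := by
  have hM : (0 : ℝ) < finrank ℚ M := by exact_mod_cast finrank_pos
  obtain ⟨D, hTD, hD⟩ := exists_support L M S
  have key := finrank_mul_delta_eq_tau_add L M S D hTD hD
  have h1 : ∑ w ∈ D, (tau L M w : ℝ) * logNorm M w = 0 :=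
    Finset.sum_eq_zero fun w _ => by rw [tau_eq_zero_of_isTameAt' L M w (htame w), Nat.cast_zero, zero_mul]
  have h2 : ∑ w ∈ D with w ∉ ssAbove L M S, ((relRamIdx L M w : ℝ) - 1) * logNorm M w = 0 :=
    Finset.sum_eq_zero fun w hw => by
      rw [Finset.mem_filter] at hw
      rw [hunr w hw.2, Nat.cast_one, sub_self, zero_mul]
  rw [h1, h2, add_zero] at key
  have : logDiffCond M (ssAbove L M S) - logDiffCond L S = 0 := by
    rcases mul_eq_zero.mp key with h | h
    · exact absurd h hM.ne'
    · exact h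
  linarith

/-- **Joshi's (4.6.8) holds exactly when nothing is dropped**: if `M/L` is unramified outside `V^{odd,ss}_M`, then
`[M:ℚ]·Δ = Σ_{w ∈ D} τ_w·log N(w)` for any admissible `D` (Thm. 4.6.1 (1) in the proof's form, under the hypothesis flag F-b
names). PROVED. [cite: MochizukiGenEll2010, Prop 1.7 (i) p.9] -/
theorem finrank_mul_delta_eq_tau_of_unramified_outside (S : Finset (HeightOneSpectrum (𝓞 L)))
    (D : Finset (HeightOneSpectrum (𝓞 M))) (hTD : ssAbove L M S ⊆ D) (hD : ∀ w, relDiffExp L M w ≠ 0 → w ∈ D)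
    (hunr : ∀ w : HeightOneSpectrum (𝓞 M), w ∉ ssAbove L M S → relRamIdx L M w = 1) :
    (finrank ℚ M : ℝ) * (logDiffCond M (ssAbove L M S) - logDiffCond L S) = ∑ w ∈ D, (tau L M w : ℝ) * logNorm M w := by
  rw [finrank_mul_delta_eq_tau_add L M S D hTD hD]
  have h2 : ∑ w ∈ D with w ∉ ssAbove L M S, ((relRamIdx L M w : ℝ) - 1) * logNorm M w = 0 :=
    Finset.sum_eq_zero fun w hw => by
      rw [Finset.mem_filter] at hw
      rw [hunr w hw.2, Nat.cast_one, sub_self, zero_mul]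
  rw [h2, add_zero]

end LogDiffCond

end Summit.ABC.IUTFork.Joshi.ATS4

end
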